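import Summits.BirchSwinnertonDyer.BirchSwinnertonDyer.Theorems.ClassRecordThreeCornerAtThreeUpperCoChain
import Summits.BirchSwinnertonDyer.BirchSwinnertonDyer.Theorems.ClassRecordThreeCornerAtThreeCoChainDefs
import Summits.BirchSwinnertonDyer.BirchSwinnertonDyer.Theorems.SchneiderFreeUpperSockets
import HarnessLib

/-!
# crux idea `cosocket-mult` (stmt-BirchSwinnertonDyer-19715, `EulerHalfNotRamNoInertSetAtFive`) — Sketch, rev 1.1

rev 1.1 (bsd-idea-9 g60, 2026-08-31) pays critic idea-crit-14 V405 PRICE P2: rev 1.0 RE-DECLARED the tree's co-socket.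
The multiplicative co-socket is the TREE predicate `X11b.IMCUpperWaldspurgerOnTreeAt p κ 𝔭 γ ι P`
(`Theorems/ClassRecordThreeCornerAtThreeCoChainDefs.lean` l.80–82, generic `p`, cell `bsd-stepL`, crux 19111), with its bookkeeping
`X11b.imcWaldspurgerOnTreeAt_iff_lower_and_upper` ∕ `X11b.imcUpperWaldspurgerOnTreeAt_of_imcWaldspurgerOnTreeAt` (ibid.) and
`X11b.sha_add_tamagawaSplit_le_of_coLinks` ∕ `X11b.shaOrder_add_two_mul_tamagawa_le_of_coLinks`
(`Theorems/ClassRecordThreeCornerAtThreeUpperCoChain.lean` §1–§2, generic `p`) — all IMPORTED here, nothing re-declared. What is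
kept from rev 1.0 is only the two currency lemmas that are not in the tree, now stated over the tree predicate:
* `indexUpperBoundLeAt_of_onTreeUpperLinks` — co-socket + control ⟹ co-STEP L at slack 0 in the Schneider-free socket currency
  `SchneiderFree.Upper.IndexUpperBoundLeAt W p K P 0` (`ord_p #Ш(E/K) + 2·ord_p ∏_ℓ c_ℓ(E) ≤ 2·ord_p[E(K):ℤP]`);
* `two_mul_index_eq_of_onTree_lower_upper_links` — both sockets + control ⟹ the EXACT index formula (no hidden slack).
The supply predicate `CoStepLAt W p` (= `X11b.Three.CoStepLAt W` with `3 ↦ p`, binder for binder) and the sorry-free road to the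
crux live in the LINE file `Lines/cosocket_mult.lean` (§0–§3). Research content = the SUPPLY of the co-socket at `p ∥ N` (NOT in
print for any `p` — Q37-4). Nothing here proves BSD or crux 19715; no statement of the summit is proved by this seat.
-/

noncomputable section

open scoped Classical

set_option linter.dupNamespace false
set_option autoImplicit false

open WeierstrassCurve NumberField IsDedekindDomain Literature.NumberTheory.EllipticCurves
open Summit.BirchSwinnertonDyer.Rank1Residual Summit.BirchSwinnertonDyer.Rank1Residual.X11b
open Summit.BirchSwinnertonDyer.Rank1Residual.X11b.AcSelmer
open Summit.BirchSwinnertonDyer.BirchSwinnertonDyer.Theorems.SchneiderFree.Upper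

namespace Summit.BirchSwinnertonDyer.BirchSwinnertonDyer.Cruxes.EulerHalfNotRamNoInertSetAtFive.CosocketMult

variable {W : WeierstrassCurve ℚ} [W.IsElliptic] [W.IsGloballyMinimal] {K : Type} [Field K]
  [NumberField K]
variable {p : ℕ} [Fact p.Prime] {κ : ZpExtension K p} {𝔭 : HeightOneSpectrum (𝓞 K)}
  {γ : Field.absoluteGaloisGroup K} [Fact (κ.IsTopGenerator γ)] {ι : K →+* ℚ_[p]}

/-- **co-STEP L at slack 0 from the on-tree upper links, in the Schneider-free socket currency** (`Ш(E/K)` finite, `K` a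
classical Heegner field for `N_E` — at `p ∥ N` this puts `p` split in `K`, Castella's setting): the TREE co-socket
`X11b.IMCUpperWaldspurgerOnTreeAt` + the control identity `X11b.ControlOnTreeAt` give `IndexUpperBoundLeAt W p K P 0`, i.e.
`ord_p #Ш(E/K) + 2·ord_p ∏_ℓ c_ℓ(E) ≤ 2·ord_p[E(K):ℤP]`, by the tree's `X11b.sha_add_tamagawaSplit_le_of_coLinks` and the currency
bridge `indexUpperBoundLeAt_iff_of_heegner_of_shaFinite`. CONDITIONAL on both links. [cite: JetchevSkinnerWan2017, §7.4.2 (eq:shaupper) (arXiv:1512.06894 p. 31)] -/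
theorem indexUpperBoundLeAt_of_onTreeUpperLinks {N : ℕ} (hN : W.conductorNorm ℤ = N)
    (hK : IsImaginaryQuadratic K) (hHe : SatisfiesHeegnerHypothesis N K)
    (hfin : (W.baseChange K).ShaFinite) {P : (W.baseChange K).toAffine.Point}
    (hIU : IMCUpperWaldspurgerOnTreeAt p κ 𝔭 γ ι P) (hCTL : ControlOnTreeAt p κ 𝔭 γ ι P) :
    IndexUpperBoundLeAt W p K P 0 := by
  refine (indexUpperBoundLeAt_iff_of_heegner_of_shaFinite hN hK hHe hfin).mpr ?_
  have h := sha_add_tamagawaSplit_le_of_coLinks hIU hCTL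
  simp only [Nat.cast_zero, mul_zero, add_zero]
  exact h

/-- **With BOTH sockets at one frame and the control identity the index formula is EXACT** (frame currency):
`2·ord_p[E(K):ℤP] = ord_p #Ш(E/K)[p^∞] + ord_p ∏_{w∣N⁺} c_w` — BSD_p(E/K)'s prediction, so the co-socket carries no hidden slack.
The lower socket is route p2's `X11b.IMCLowerWaldspurgerOnTreeAt` (ErratumRoadFive's `OpenInputIMC` road); bookkeeping over
`X11b.two_mul_index_le_of_onTreeLowerLinks` and `X11b.sha_add_tamagawaSplit_le_of_coLinks`. [folklore] -/
theorem two_mul_index_eq_of_onTree_lower_upper_links {P : (W.baseChange K).toAffine.Point}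
    (hIL : IMCLowerWaldspurgerOnTreeAt p κ 𝔭 γ ι P) (hIU : IMCUpperWaldspurgerOnTreeAt p κ 𝔭 γ ι P)
    (hCTL : ControlOnTreeAt p κ 𝔭 γ ι P) :
    2 * (padicValNat p (AddSubgroup.zmultiples P).index : ℤ) =
      (padicValNat p (Nat.card (AddCommGroup.primaryComponent (W.baseChange K).sha p)) : ℤ) +
        padicValNat p (tamagawaProductSplit W K) := by
  have h1 := two_mul_index_le_of_onTreeLowerLinks hIL hCTL
  have h2 := sha_add_tamagawaSplit_le_of_coLinks hIU hCTL
  omega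

/-- Sanity (P2): the co-socket used above IS the tree decl of `…CornerAtThreeCoChainDefs.lean`, and route R1's equality link
splits into the two one-sided sockets by the TREE lemma (nothing re-declared in this file). -/
example {P : (W.baseChange K).toAffine.Point} :
    IMCWaldspurgerOnTreeAt p κ 𝔭 γ ι P ↔
      IMCLowerWaldspurgerOnTreeAt p κ 𝔭 γ ι P ∧ X11b.IMCUpperWaldspurgerOnTreeAt p κ 𝔭 γ ι P :=
  imcWaldspurgerOnTreeAt_iff_lower_and_upper

end Summit.BirchSwinnertonDyer.BirchSwinnertonDyer.Cruxes.EulerHalfNotRamNoInertSetAtFive.CosocketMult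

end
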